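import Summits.FinalStateConjecture.FinalStateConjecture.Theses.BondiDrainDispersal
import Literature.Geometry.Lorentzian.EventHorizon
import HarnessLib

/-!
# Crux `HorizonlessMustDrain` (stmt-FinalStateConjecture-9976) — normal forms of the horizon hypothesis

Route `BondiDrainDispersal` inlines "the development has NO EVENT HORIZON" as the negation of
"some event `q` lies outside `I⁻(γ(dom ∩ [0, ∞)))` for every future-complete normalised null ray
`γ` from the data hypersurface", with the standing Levi-Civita instance bound inside the negated
proposition.  The tree meanwhile carries the intrinsic black-hole vocabulary built on exactly this
clause (`Literature/Geometry/Lorentzian/VisibleIncompleteNullRay.lean`: `DataEmbedding.IsVisibleEvent`,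
`visibleRegion`; `EventHorizon.lean`: `DataEmbedding.blackHoleRegion = (visibleRegion)ᶜ`, whose module
docstring records that "`BondiDrainDispersal`'s horizonless developments are exactly those with
`blackHoleRegion = ∅`" without proving it).  This file proves that bookkeeping once, so that every
seat working the crux (lines, stub workers, the disprover) can use the `EventHorizon` API verbatim:

* `noHorizon_iff_forall_isVisibleEvent` — the negated inlined clause is `∀ q, 𝒟.IsVisibleEvent q`;
* `noHorizon_iff_visibleRegion_eq_univ` — equivalently `𝒟.visibleRegion = univ`;
* `noHorizon_iff_blackHoleRegion_eq_empty` — equivalently `𝒟.blackHoleRegion = ∅` (`𝓑 = ∅`);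
* `horizonlessMustDrain_iff_blackHoleRegion_form` — the crux, by name, is equivalent to
  "admissible `D`, MGHD `𝒟`, complete `𝓘⁺` (sojourn form), `𝓑 = ∅` ⇒ vanishing final Bondi mass";
* `horizonlessMustDrain_iff_visible_form` — the same with `∀ q, 𝒟.IsVisibleEvent q`.

The instance binder `∀ [𝒟.metric.HasLeviCivita]` is harmless because `HasLeviCivita` is a
proposition with the global proof `PseudoRiemannianMetric.hasLeviCivita` (proof irrelevance makes
every instance definitionally the canonical one); the lemmas below discharge it explicitly.
Helper file for the crux (`--supports stmt-FinalStateConjecture-9976`); it proves no route item.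
-/

noncomputable section

open Set Literature.Geometry.Lorentzian
open scoped Manifold ContDiff

namespace Summit.FinalStateConjecture.FinalStateConjecture.Theorems.BondiDrainDispersalHorizonlessMustDrain

-- D-0017: single-problem summit, `Summit.<S>.<S>.…` by design.
set_option linter.dupNamespace false

open Summit.FinalStateConjecture.FinalStateConjecture.Theses.BondiDrainDispersal (HorizonlessMustDrain)

variable {X : Type} [TopologicalSpace X] [ChartedSpace E3 X] [IsManifold (𝓡 3) ∞ X]
  [ConnectedSpace X] {D : InitialDataSet (𝓡 3) X}

/-- **No event horizon ⇔ every event is visible from infinity.**  The negated horizon clause of the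
crux (verbatim the hypothesis inlined in `HorizonlessMustDrain`, Levi-Civita instance bound inside)
is `∀ q, 𝒟.IsVisibleEvent q` for the Levi-Civita connection of `g` in context (any two instances
agree by proof irrelevance). Hawking–Ellis 1973, §9.2, p. 312; Wald 1984, §12.1, p. 300. [folklore] -/
theorem noHorizon_iff_forall_isVisibleEvent (𝒟 : VacuumCauchyDevelopment D)
    [𝒟.metric.HasLeviCivita] :
    (¬ ∀ [𝒟.metric.HasLeviCivita], ∃ q : 𝒟.carrier, ∀ (p : X) (γ : ℝ → 𝒟.carrier) (dom : Set ℝ),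
        𝒟.metric.IsNormalisedNullRayFrom 𝒟.timeOrientation 𝒟.embed 𝒟.normal p γ dom →
          ¬ BddAbove dom →
            q ∉ 𝒟.metric.chronologicalPast 𝒟.timeOrientation (γ '' (dom ∩ Set.Ici 0))) ↔
      ∀ q : 𝒟.carrier, 𝒟.toDataEmbedding.IsVisibleEvent q := by
  constructor
  · intro h q
    by_contra hq
    exact h ⟨q, (𝒟.toDataEmbedding.not_isVisibleEvent_iff).1 hq⟩
  · intro h hH
    obtain ⟨q, hq⟩ := hH
    exact (𝒟.toDataEmbedding.not_isVisibleEvent_iff).2 hq (h q)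

/-- **No event horizon ⇔ the visible region is everything** (`I⁻(𝓘⁺) ∩ M = M`, intrinsically:
`DataEmbedding.visibleRegion = univ`). Wald 1984, §12.1, p. 300. [folklore] -/
theorem noHorizon_iff_visibleRegion_eq_univ (𝒟 : VacuumCauchyDevelopment D)
    [𝒟.metric.HasLeviCivita] :
    (¬ ∀ [𝒟.metric.HasLeviCivita], ∃ q : 𝒟.carrier, ∀ (p : X) (γ : ℝ → 𝒟.carrier) (dom : Set ℝ),
        𝒟.metric.IsNormalisedNullRayFrom 𝒟.timeOrientation 𝒟.embed 𝒟.normal p γ dom →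
          ¬ BddAbove dom →
            q ∉ 𝒟.metric.chronologicalPast 𝒟.timeOrientation (γ '' (dom ∩ Set.Ici 0))) ↔
      𝒟.toDataEmbedding.visibleRegion = univ := by
  rw [noHorizon_iff_forall_isVisibleEvent, eq_univ_iff_forall]
  rfl

/-- **No event horizon ⇔ the black-hole region is empty** (`𝓑 = M ∖ J⁻(𝓘⁺) = ∅`,
`DataEmbedding.blackHoleRegion`): the form in which `EventHorizon.lean` describes the horizonless
developments of route `BondiDrainDispersal`. Wald 1984, §12.1, (12.1.2). [folklore] -/
theorem noHorizon_iff_blackHoleRegion_eq_empty (𝒟 : VacuumCauchyDevelopment D)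
    [𝒟.metric.HasLeviCivita] :
    (¬ ∀ [𝒟.metric.HasLeviCivita], ∃ q : 𝒟.carrier, ∀ (p : X) (γ : ℝ → 𝒟.carrier) (dom : Set ℝ),
        𝒟.metric.IsNormalisedNullRayFrom 𝒟.timeOrientation 𝒟.embed 𝒟.normal p γ dom →
          ¬ BddAbove dom →
            q ∉ 𝒟.metric.chronologicalPast 𝒟.timeOrientation (γ '' (dom ∩ Set.Ici 0))) ↔
      𝒟.toDataEmbedding.blackHoleRegion = ∅ := by
  rw [noHorizon_iff_visibleRegion_eq_univ, DataEmbedding.blackHoleRegion_eq_compl,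
    compl_empty_iff]

/-- **The crux in black-hole form.**  `HorizonlessMustDrain` (by name) is equivalent to: for every
admissible datum `D` and every maximal vacuum Cauchy development `𝒟` of `D` with complete future null
infinity (sojourn form) whose intrinsic black-hole region is empty, the final Bondi mass vanishes.
[folklore] -/
theorem horizonlessMustDrain_iff_blackHoleRegion_form :
    HorizonlessMustDrain ↔
      ∀ (X : Type) [TopologicalSpace X] [ChartedSpace E3 X] [IsManifold (𝓡 3) ∞ X] [T2Space X]
        [SecondCountableTopology X] [ConnectedSpace X],
        ∀ D ∈ admissibleVacuumData X, ∀ 𝒟 : VacuumCauchyDevelopment D, 𝒟.IsMaximal →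
          Summit.FinalStateConjecture.HasCompleteNullInfinity 𝒟.toCauchyDevelopment →
            (∀ [𝒟.metric.HasLeviCivita], 𝒟.toDataEmbedding.blackHoleRegion = ∅) →
              𝒟.toCauchyDevelopment.HasVanishingFinalBondiMass := by
  constructor
  · intro h X _ _ _ _ _ _ D hD 𝒟 hmax hscri hB
    refine h X D hD 𝒟 hmax hscri ?_
    haveI : 𝒟.metric.HasLeviCivita := 𝒟.metric.toPseudoRiemannianMetric.hasLeviCivita
    have hB' : 𝒟.toDataEmbedding.blackHoleRegion = ∅ := hB
    exact (noHorizon_iff_blackHoleRegion_eq_empty 𝒟).2 hB'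
  · intro h X _ _ _ _ _ _ D hD 𝒟 hmax hscri hH
    refine h X D hD 𝒟 hmax hscri ?_
    intro _
    exact (noHorizon_iff_blackHoleRegion_eq_empty 𝒟).1 hH

/-- **The crux in visibility form.**  `HorizonlessMustDrain` (by name) is equivalent to: for every
admissible datum `D` and every maximal vacuum Cauchy development `𝒟` of `D` with complete future null
infinity (sojourn form) all of whose events are visible from infinity, the final Bondi mass vanishes.
[folklore] -/
theorem horizonlessMustDrain_iff_visible_form :
    HorizonlessMustDrain ↔
      ∀ (X : Type) [TopologicalSpace X] [ChartedSpace E3 X] [IsManifold (𝓡 3) ∞ X] [T2Space X]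
        [SecondCountableTopology X] [ConnectedSpace X],
        ∀ D ∈ admissibleVacuumData X, ∀ 𝒟 : VacuumCauchyDevelopment D, 𝒟.IsMaximal →
          Summit.FinalStateConjecture.HasCompleteNullInfinity 𝒟.toCauchyDevelopment →
            (∀ [𝒟.metric.HasLeviCivita], ∀ q : 𝒟.carrier, 𝒟.toDataEmbedding.IsVisibleEvent q) →
              𝒟.toCauchyDevelopment.HasVanishingFinalBondiMass := by
  constructor
  · intro h X _ _ _ _ _ _ D hD 𝒟 hmax hscri hV
    refine h X D hD 𝒟 hmax hscri ?_
    haveI : 𝒟.metric.HasLeviCivita := 𝒟.metric.toPseudoRiemannianMetric.hasLeviCivita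
    have hV' : ∀ q : 𝒟.carrier, 𝒟.toDataEmbedding.IsVisibleEvent q := hV
    exact (noHorizon_iff_forall_isVisibleEvent 𝒟).2 hV'
  · intro h X _ _ _ _ _ _ D hD 𝒟 hmax hscri hH
    refine h X D hD 𝒟 hmax hscri ?_
    intro _
    exact (noHorizon_iff_forall_isVisibleEvent 𝒟).1 hH


/-- **Registered glue stub `stub_horizonNormalForm`** of crux stmt-FinalStateConjecture-9976 (not a skeleton
obligation: it registers the black-hole normal form so that this helper file lands `--supports`): the crux
by name is equivalent to its `blackHoleRegion = ∅` form (`horizonlessMustDrain_iff_blackHoleRegion_form`).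
[folklore] -/
theorem stub_horizonNormalForm : open scoped Manifold in (Summit.FinalStateConjecture.FinalStateConjecture.Theses.BondiDrainDispersal.HorizonlessMustDrain ↔ ∀ (X : Type) [TopologicalSpace X] [ChartedSpace Literature.Geometry.Lorentzian.E3 X] [IsManifold (𝓡 3) ((⊤ : ℕ∞) : WithTop ℕ∞) X] [T2Space X] [SecondCountableTopology X] [ConnectedSpace X], ∀ D ∈ Literature.Geometry.Lorentzian.admissibleVacuumData X, ∀ 𝒟 : Literature.Geometry.Lorentzian.VacuumCauchyDevelopment D, 𝒟.IsMaximal → Summit.FinalStateConjecture.HasCompleteNullInfinity 𝒟.toCauchyDevelopment → (∀ [𝒟.metric.HasLeviCivita], 𝒟.toDataEmbedding.blackHoleRegion = ∅) → 𝒟.toCauchyDevelopment.HasVanishingFinalBondiMass) :=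
  horizonlessMustDrain_iff_blackHoleRegion_form

end Summit.FinalStateConjecture.FinalStateConjecture.Theorems.BondiDrainDispersalHorizonlessMustDrain

end
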